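import Summits.AtomisticToContinuum.Crystallization.Theorems.ExcessDecayLiouvillePhononStabilityCertPolyB

/-!
# Near-certificate layer IV: the slack-absorbing check

Support file for crux `PhononStability` (line `contragredient-window-collapse`): recoverable tables, box bounds of monomials, and the slack-absorbing check `certCheckS` (the residual of target − slack − certificate is dominated class by class by the slack) with its soundness. [folklore]
-/

noncomputable section

open scoped BigOperators Classical InnerProductSpace
open Filter Set Function
open Summit.AtomisticToContinuum.Crystallization.Theorems.PhononStabilityNegative

namespace Summit.AtomisticToContinuum.Crystallization.Theorems.PhononStabilityCWC.Cert

local notation "E3" => EuclideanSpace ℝ (Fin 3)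

/-! ## Residual control: pair recovery and the slack-absorbing check -/

/-- pair tables of a list of pair terms -/
def pairTables (P : List (BondClass × Mat)) : TPTable := P.flatMap fun p => pairTable p.1 p.2

/-- evaluation of the pair tables of a list. [folklore] -/
theorem tpEval_pairTables {w : Label → E3} (hw : (support w).Finite) (P : List (BondClass × Mat)) :
    tpEval (pairTables P) w = (P.map fun p => pairEval p.1 p.2 w).sum := by
  unfold pairTables
  induction P with
  | nil => rfl
  | cons p rest ih => simp [List.flatMap_cons, tpEval_append, ih, pairEval_eq_tpEval hw]

/-- candidate pair terms of a table: every non-self canonical entry `((m,m',n), M)` (both orientations merged by `canon3`)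
gives the pair term `(m,m',n) ↦ −M/2` -/
def recoverPairs (T : TPTable) : List (BondClass × Mat) :=
  (canon3 T).filterMap fun e => if e.1.1 = e.1.2.1 ∧ e.1.2.2 = 0 then none else some (e.1, fun i j => -e.2 i j / 2)

/-- the table is (syntactically verified to be) the two-point table of its recovered pair terms -/
def recoverable (T : TPTable) : Bool := isZeroT (pairTables (recoverPairs T) ++ smulT (-1) T)

/-- a recoverable table evaluates as its recovered pairs. [folklore] -/
theorem tpEval_of_recoverable {w : Label → E3} (hw : (support w).Finite) {T : TPTable} (h : recoverable T = true) :
    tpEval T w = ((recoverPairs T).map fun p => pairEval p.1 p.2 w).sum := by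
  have h0 := tpEval_eq_zero_of_isZeroT hw h
  rw [tpEval_append, tpEval_smulT, tpEval_pairTables hw] at h0
  push_cast at h0
  linarith

/-- `Σ |K i j|` -/
def absSum (K : Mat) : ℚ := ∑ i, ∑ j, |K i j|

/-- the covariant plain form `Σ_k ‖Δ̃‖²` of a class -/
def covPlain (c : BondClass) (w : Label → E3) : ℝ := pairEvalR c (fun i j => if i = j then 1 else 0) w

/-- `bilR` of the identity is the sum of squares. [folklore] -/
theorem bilR_one (x : Fin 3 → ℝ) : bilR (fun i j => if i = j then (1 : ℝ) else 0) x x = ∑ i, x i ^ 2 := by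
  unfold bilR
  refine Finset.sum_congr rfl fun i _ => ?_
  rw [Finset.sum_eq_single i (fun j _ hj => by simp [Ne.symm hj]) (by simp)]
  simp [sq]

/-- the covariant plain form is nonnegative. [folklore] -/
theorem covPlain_nonneg (c : BondClass) (w : Label → E3) : 0 ≤ covPlain c w := by
  unfold covPlain pairEvalR
  refine tsum_nonneg fun k => ?_
  rw [bilR_one]
  exact Finset.sum_nonneg fun i _ => sq_nonneg _

/-- a quadratic form is bounded by `Σ|K i j|` times the sum of squares. [folklore] -/
theorem bil_abs_le (K : Mat) (x : Fin 3 → ℝ) : |bil K x x| ≤ (absSum K : ℝ) * ∑ i, x i ^ 2 := by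
  unfold bil absSum
  push_cast
  rw [Finset.sum_mul]
  refine (Finset.abs_sum_le_sum_abs _ _).trans (Finset.sum_le_sum fun i _ => ?_)
  rw [Finset.sum_mul]
  refine (Finset.abs_sum_le_sum_abs _ _).trans (Finset.sum_le_sum fun j _ => ?_)
  rw [abs_mul, abs_mul]
  have h2 : |x i| * |x j| ≤ ∑ l, x l ^ 2 := by
    have hi : x i ^ 2 ≤ ∑ l, x l ^ 2 := Finset.single_le_sum (fun l _ => sq_nonneg (x l)) (Finset.mem_univ i)
    have hj : x j ^ 2 ≤ ∑ l, x l ^ 2 := Finset.single_le_sum (fun l _ => sq_nonneg (x l)) (Finset.mem_univ j)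
    have := two_mul_le_add_sq (|x i|) (|x j|)
    rw [sq_abs, sq_abs] at this
    nlinarith [abs_nonneg (x i), abs_nonneg (x j)]
  calc |((K i j : ℚ) : ℝ)| * |x i| * |x j| = |((K i j : ℚ) : ℝ)| * (|x i| * |x j|) := by ring
    _ ≤ |((K i j : ℚ) : ℝ)| * ∑ l, x l ^ 2 := mul_le_mul_of_nonneg_left h2 (abs_nonneg _)

/-- a pair form is bounded by `absSum` times the covariant plain form. [folklore] -/
theorem abs_pairEval_le {w : Label → E3} (hw : (support w).Finite) (c : BondClass) (K : Mat) :
    |pairEval c K w| ≤ (absSum K : ℝ) * covPlain c w := by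
  unfold pairEval covPlain pairEvalR
  have hs := summable_pairR hw c (fun i j => ((K i j : ℚ) : ℝ))
  have hs1 := summable_pairR hw c (fun i j => if i = j then (1 : ℝ) else 0)
  rw [← tsum_mul_left]
  have h1 : |∑' k, bilR (fun i j => ((K i j : ℚ) : ℝ)) (covDiff c w k) (covDiff c w k)| ≤
      ∑' k, |bilR (fun i j => ((K i j : ℚ) : ℝ)) (covDiff c w k) (covDiff c w k)| := by
    have := norm_tsum_le_tsum_norm hs.norm
    simpa only [Real.norm_eq_abs] using this
  refine h1.trans ?_
  refine Summable.tsum_le_tsum (fun k => ?_) hs.abs (hs1.mul_left _)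
  rw [bilR_one]
  exact bil_abs_le K (covDiff c w k)

/-- bound of `|x^α|` from listed box half-widths (unlisted variables would get `0`, so the check also requires `monoListed`) -/
def monoBound (hw : List (ℕ × ℚ)) (m : Mono) : ℚ := (m.map fun v => (hw.lookup v).getD 0).prod

/-- all variables of a monomial are listed in the box -/
def monoListed (hw : List (ℕ × ℚ)) (m : Mono) : Bool := m.all fun v => (hw.lookup v).isSome

/-- residual charge of class `c`: `Σ_{(α, T) ∈ R} B_α · Σ_{(c, K) ∈ recover T} absSum K` -/
def resCharge (hw : List (ℕ × ℚ)) (R : PolyPF) (c : BondClass) : ℚ :=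
  (R.map fun e => monoBound hw e.1 * ((recoverPairs e.2).map fun p => if p.1 = c then absSum p.2 else 0).sum).sum

/-- slack data: per-class coefficients of covariant plain forms subtracted from the target before certification -/
abbrev Slack := List (BondClass × ℚ)

/-- the polynomial pair form `Σ_c s_c · covPlain_c` (constant monomial) -/
def slackPPF (S : Slack) : PolyPF := [([], pairTables (S.map fun p => (p.1, fun i j => if i = j then p.2 else 0)))]


/-- evaluation of the slack form. [folklore] -/
theorem tpEval_slack {w : Label → E3} (hw : (support w).Finite) (S : Slack) :
    tpEval (pairTables (S.map fun p => (p.1, fun i j => if i = j then p.2 else 0))) w =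
      (S.map fun p => (p.2 : ℝ) * covPlain p.1 w).sum := by
  rw [tpEval_pairTables hw, List.map_map]
  congr 1
  refine List.map_congr_left fun p _ => ?_
  simp only [Function.comp_apply, pairEval_eq_pairEvalR, covPlain, ← pairEvalR_smul]
  congr 1
  funext i j
  split_ifs <;> simp

/-- slack coefficient of class `c` -/
def slackOf (S : Slack) (c : BondClass) : ℚ := (S.map fun p => if p.1 = c then p.2 else 0).sum

/-- residual charge of class `c` from precomputed `(box bound, recovered pairs)` per monomial -/
def resChargeP (RP : List (ℚ × List (BondClass × Mat))) (c : BondClass) : ℚ :=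
  (RP.map fun g => g.1 * (g.2.map fun p => if p.1 = c then absSum p.2 else 0).sum).sum

/-- the precomputed residual charge is the residual charge. [folklore] -/
theorem resChargeP_eq (hw : List (ℕ × ℚ)) (R : PolyPF) (c : BondClass) :
    resChargeP (R.map fun e => (monoBound hw e.1, recoverPairs e.2)) c = resCharge hw R c := by
  simp [resChargeP, resCharge, List.map_map, Function.comp_def]

/-- **THE SLACK-ABSORBING CHECK:** target minus slack minus the certified form is, monomial by monomial, a recoverable
pair form on classes carrying slack, whose coefficients, weighted by the box bounds of the monomials, are dominated class
by class by the slack. -/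
def certCheckS (T : PolyPF) (S : Slack) (hw : List (ℕ × ℚ)) (C : CellCert) : Bool :=
  let R := groupPM (T ++ negPPF (slackPPF S) ++ negPPF C.ppf)
  let RP := R.map fun e => (monoBound hw e.1, recoverPairs e.2)
  let SC := S.map Prod.fst
  C.wellFormed && (R.all fun e => recoverable e.2 && monoListed hw e.1) &&
    (RP.all fun g => g.2.all fun p => decide (p.1 ∈ SC)) &&
      (SC.all fun c => decide (resChargeP RP c ≤ slackOf S c))

/-- swapping a list sum with a finset sum -/
theorem list_sum_finset_sum {α β : Type*} (L : List α) (U : Finset β) (f : α → β → ℝ) :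
    (L.map fun x => ∑ c ∈ U, f x c).sum = ∑ c ∈ U, (L.map fun x => f x c).sum := by
  induction L with
  | nil => simp
  | cons a rest ih => simp [ih, Finset.sum_add_distrib]

/-- monomials are bounded by the product of the box bounds. [folklore] -/
theorem abs_monoVal_le (hw : List (ℕ × ℚ)) (x : ℕ → ℝ) (hx : ∀ p ∈ hw, |x p.1| ≤ (p.2 : ℝ)) (m : Mono)
    (hm : monoListed hw m = true) : |monoVal x m| ≤ (monoBound hw m : ℝ) := by
  unfold monoVal monoBound
  unfold monoListed at hm
  rw [List.all_eq_true] at hm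
  induction m with
  | nil => simp
  | cons v rest ih =>
      simp only [List.map_cons, List.prod_cons, Rat.cast_mul, abs_mul]
      have hv := hm v (List.mem_cons_self ..)
      obtain ⟨b, hb⟩ := Option.isSome_iff_exists.mp hv
      have hmem : (v, b) ∈ hw := by
        obtain ⟨l₁, l₂, hl, -⟩ := List.lookup_eq_some_iff.mp hb
        rw [hl]; simp
      have h1 : |x v| ≤ (b : ℝ) := hx (v, b) hmem
      rw [hb, Option.getD_some]
      exact mul_le_mul h1 (ih fun u hu => hm u (List.mem_cons_of_mem _ hu)) (abs_nonneg _)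
        ((abs_nonneg _).trans h1)

/-- triangle inequality for list sums. [folklore] -/
theorem list_abs_sum_le_sum_abs (l : List ℝ) : |l.sum| ≤ (l.map fun t => |t|).sum := by
  induction l with
  | nil => simp
  | cons a rest ih => simpa using (abs_add_le a rest.sum).trans (add_le_add_right ih _)

/-- a polynomial pair form of recoverable tables is bounded by its residual charges. [folklore] -/
theorem evalPPF_abs_le {w : Label → E3} (hw : (support w).Finite) (hwb : List (ℕ × ℚ)) (x : ℕ → ℝ)
    (hx : ∀ p ∈ hwb, |x p.1| ≤ (p.2 : ℝ)) (R : PolyPF)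
    (hR : ∀ e ∈ R, recoverable e.2 = true ∧ monoListed hwb e.1 = true) :
    |evalPPF R x w| ≤ (R.map fun e => (monoBound hwb e.1 : ℝ) *
      ((recoverPairs e.2).map fun p => (absSum p.2 : ℝ) * covPlain p.1 w).sum).sum := by
  induction R with
  | nil => simp
  | cons e rest ih =>
      rw [evalPPF_cons, List.map_cons, List.sum_cons]
      have he := hR e (List.mem_cons_self ..)
      refine (abs_add_le _ _).trans (add_le_add ?_ (ih fun f hf => hR f (List.mem_cons_of_mem _ hf)))
      rw [abs_mul, tpEval_of_recoverable hw he.1]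
      refine mul_le_mul (abs_monoVal_le hwb x hx e.1 he.2) ?_ (abs_nonneg _)
        ((abs_nonneg _).trans (abs_monoVal_le hwb x hx e.1 he.2))
      refine (list_abs_sum_le_sum_abs _).trans ?_
      rw [List.map_map]
      refine List.sum_le_sum fun p _ => ?_
      exact abs_pairEval_le hw p.1 p.2

/-- real-valued residual charge (the cast of `resCharge`, written as the list expression used in the proofs) -/
theorem resCharge_cast (hwb : List (ℕ × ℚ)) (R : PolyPF) (c : BondClass) :
    (resCharge hwb R c : ℝ) =
      (R.map fun e => (monoBound hwb e.1 : ℝ) *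
        ((recoverPairs e.2).map fun p => if p.1 = c then (absSum p.2 : ℝ) else 0).sum).sum := by
  have inner : ∀ L : List (BondClass × Mat),
      (((L.map fun p => if p.1 = c then absSum p.2 else 0).sum : ℚ) : ℝ) =
        (L.map fun p => if p.1 = c then (absSum p.2 : ℝ) else 0).sum := by
    intro L
    induction L with
    | nil => simp
    | cons p rest ih =>
        simp only [List.map_cons, List.sum_cons, Rat.cast_add, ih]
        split_ifs <;> simp
  unfold resCharge
  induction R with
  | nil => simp
  | cons e rest ih =>
      simp only [List.map_cons, List.sum_cons, Rat.cast_add, Rat.cast_mul, ih, inner]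

/-- regrouping the residual bound by classes -/
theorem resBound_regroup (hwb : List (ℕ × ℚ)) (R : PolyPF) (U : Finset BondClass)
    (hU : ∀ e ∈ R, ∀ p ∈ recoverPairs e.2, p.1 ∈ U) (g : BondClass → ℝ) :
    (R.map fun e => (monoBound hwb e.1 : ℝ) * ((recoverPairs e.2).map fun p => (absSum p.2 : ℝ) * g p.1).sum).sum =
      ∑ c ∈ U, (resCharge hwb R c : ℝ) * g c := by
  have h1 : ∀ e ∈ R, ((recoverPairs e.2).map fun p => (absSum p.2 : ℝ) * g p.1).sum =
      ∑ c ∈ U, ((recoverPairs e.2).map fun p => if p.1 = c then (absSum p.2 : ℝ) * g c else 0).sum := by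
    intro e he
    rw [← list_sum_finset_sum]
    congr 1
    refine List.map_congr_left fun p hp => ?_
    rw [Finset.sum_ite_eq, if_pos (hU e he p hp)]
  calc (R.map fun e => (monoBound hwb e.1 : ℝ) * ((recoverPairs e.2).map fun p => (absSum p.2 : ℝ) * g p.1).sum).sum
      = (R.map fun e => ∑ c ∈ U, (monoBound hwb e.1 : ℝ) *
          ((recoverPairs e.2).map fun p => if p.1 = c then (absSum p.2 : ℝ) * g c else 0).sum).sum := by
        congr 1
        refine List.map_congr_left fun e he => ?_
        rw [h1 e he, Finset.mul_sum]
    _ = ∑ c ∈ U, (R.map fun e => (monoBound hwb e.1 : ℝ) *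
          ((recoverPairs e.2).map fun p => if p.1 = c then (absSum p.2 : ℝ) * g c else 0).sum).sum :=
        list_sum_finset_sum _ _ _
    _ = ∑ c ∈ U, (resCharge hwb R c : ℝ) * g c := by
        refine Finset.sum_congr rfl fun c _ => ?_
        rw [resCharge_cast, ← List.sum_map_mul_right]
        congr 1
        refine List.map_congr_left fun e _ => ?_
        rw [mul_assoc, ← List.sum_map_mul_right]
        congr 2
        refine List.map_congr_left fun p _ => ?_
        split_ifs <;> simp


/-- regrouping the slack class by class. [folklore] -/
theorem slack_regroup (S : Slack) (U : Finset BondClass) (hU : ∀ p ∈ S, p.1 ∈ U) (g : BondClass → ℝ) :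
    (S.map fun p => (p.2 : ℝ) * g p.1).sum = ∑ c ∈ U, (slackOf S c : ℝ) * g c := by
  have inner : ∀ c, ((slackOf S c : ℚ) : ℝ) = (S.map fun p => if p.1 = c then (p.2 : ℝ) else 0).sum := by
    intro c
    unfold slackOf
    induction S with
    | nil => simp
    | cons p rest ih =>
        simp only [List.map_cons, List.sum_cons, Rat.cast_add]
        rw [ih (fun q hq => hU q (List.mem_cons_of_mem _ hq))]
        split_ifs <;> simp
  calc (S.map fun p => (p.2 : ℝ) * g p.1).sum
      = (S.map fun p => ∑ c ∈ U, if p.1 = c then (p.2 : ℝ) * g c else 0).sum := by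
        congr 1
        refine List.map_congr_left fun p hp => ?_
        rw [Finset.sum_ite_eq, if_pos (hU p hp)]
    _ = ∑ c ∈ U, (S.map fun p => if p.1 = c then (p.2 : ℝ) * g c else 0).sum := list_sum_finset_sum _ _ _
    _ = ∑ c ∈ U, (slackOf S c : ℝ) * g c := by
        refine Finset.sum_congr rfl fun c _ => ?_
        rw [inner, ← List.sum_map_mul_right]
        congr 1
        refine List.map_congr_left fun p _ => ?_
        split_ifs <;> simp

/-- **SOUNDNESS OF THE SLACK-ABSORBING CHECK.** -/
theorem certCheckS_sound {T : PolyPF} {S : Slack} {hwb : List (ℕ × ℚ)} {C : CellCert}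
    (h : certCheckS T S hwb C = true) (x : ℕ → ℝ)
    (hbox : ∀ b ∈ C.boxes, |x b.1| ≤ (b.2.1 : ℝ)) (hhw : ∀ p ∈ hwb, |x p.1| ≤ (p.2 : ℝ))
    (hlinks : ∀ l ∈ C.links, spEval l.1 x = 0) (hwins : ∀ e ∈ C.wins, 0 ≤ spEval e.1 x)
    {w : Label → E3} (hw : (support w).Finite) : 0 ≤ evalPPF T x w := by
  unfold certCheckS at h
  simp only [Bool.and_eq_true] at h
  obtain ⟨⟨⟨hC, hR⟩, hmem⟩, hdom⟩ := h
  rw [List.all_eq_true] at hR hdom hmem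
  set R := groupPM (T ++ negPPF (slackPPF S) ++ negPPF C.ppf) with hRdef
  -- evaluation identity: T = slack + cert + R
  have hid : evalPPF T x w = evalPPF (slackPPF S) x w + evalPPF C.ppf x w + evalPPF R x w := by
    have := evalPPF_groupPM (T ++ negPPF (slackPPF S) ++ negPPF C.ppf) x w
    rw [← hRdef, evalPPF_append, evalPPF_append, evalPPF_negPPF, evalPPF_negPPF] at this
    linarith
  -- the certified part is ≥ 0 (same argument as `certCheck_sound`)
  have hcert : 0 ≤ evalPPF C.ppf x w := C.ppf_nonneg hC x hbox hlinks hwins hw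
  -- the slack part
  have hslack : evalPPF (slackPPF S) x w = (S.map fun p => (p.2 : ℝ) * covPlain p.1 w).sum := by
    simp [slackPPF, evalPPF, monoVal, tpEval_slack hw]
  -- the residual bound
  have hres : |evalPPF R x w| ≤ (R.map fun e => (monoBound hwb e.1 : ℝ) *
      ((recoverPairs e.2).map fun p => (absSum p.2 : ℝ) * covPlain p.1 w).sum).sum :=
    evalPPF_abs_le hw hwb x hhw R fun e he => by
      have := hR e he
      simp only [Bool.and_eq_true] at this
      exact this
  -- regroup both by classes over U := the classes carrying slack
  set U : Finset BondClass := (S.map Prod.fst).toFinset with hUdef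
  have hU1 : ∀ e ∈ R, ∀ p ∈ recoverPairs e.2, p.1 ∈ U := by
    intro e he p hp
    rw [hUdef, List.mem_toFinset]
    have h1 := hmem (monoBound hwb e.1, recoverPairs e.2) (List.mem_map.mpr ⟨e, he, rfl⟩)
    rw [List.all_eq_true] at h1
    have h2 := h1 p hp
    simpa using h2
  have hU2 : ∀ p ∈ S, p.1 ∈ U := by
    intro p hp
    rw [hUdef, List.mem_toFinset]
    exact List.mem_map.mpr ⟨p, hp, rfl⟩
  rw [resBound_regroup hwb R U hU1 (fun c => covPlain c w)] at hres
  rw [slack_regroup S U hU2 (fun c => covPlain c w)] at hslack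
  have hcmp : ∑ c ∈ U, (resCharge hwb R c : ℝ) * covPlain c w ≤ ∑ c ∈ U, (slackOf S c : ℝ) * covPlain c w := by
    refine Finset.sum_le_sum fun c hc => mul_le_mul_of_nonneg_right ?_ (covPlain_nonneg c w)
    have := hdom c (List.mem_toFinset.mp (by rw [hUdef] at hc; exact hc))
    simp only [decide_eq_true_eq, resChargeP_eq] at this
    exact_mod_cast this
  have hRle : -evalPPF (slackPPF S) x w ≤ evalPPF R x w := by
    rw [hslack]
    have := neg_abs_le (evalPPF R x w)
    linarith
  linarith

/-- Anchor of this support file (registered stub of the line skeleton). -/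
theorem stub_certSlack : ∀ (T : PolyPF) (S : Slack) (hwb : List (ℕ × ℚ)) (C : CellCert),
    certCheckS T S hwb C = true → ∀ x : ℕ → ℝ, (∀ b ∈ C.boxes, |x b.1| ≤ (b.2.1 : ℝ)) →
    (∀ p ∈ hwb, |x p.1| ≤ (p.2 : ℝ)) → (∀ l ∈ C.links, spEval l.1 x = 0) → (∀ e ∈ C.wins, 0 ≤ spEval e.1 x) →
    ∀ w : Label → EuclideanSpace ℝ (Fin 3), (Function.support w).Finite → 0 ≤ evalPPF T x w :=
  fun _ _ _ _ h x hbox hhw hlinks hwins _ hw => certCheckS_sound h x hbox hhw hlinks hwins hw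

end Summit.AtomisticToContinuum.Crystallization.Theorems.PhononStabilityCWC.Cert

end
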